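import Mathlib
import Literature.RepresentationTheory.FiniteGroups.KLRGradedCellularBasis
import Summits.MatrixMultiplication.MatrixMultiplication.Theorems.SnSubsetDichotomyNoThresholdSubsetTripleSmallWeightTail
import Summits.MatrixMultiplication.MatrixMultiplication.Theorems.SnSubsetDichotomyNoThresholdSubsetTripleStubTransposeDegree
import Summits.MatrixMultiplication.MatrixMultiplication.Theorems.SnSubsetDichotomyNoThresholdSubsetTripleSwPairs
import Summits.MatrixMultiplication.MatrixMultiplication.Theorems.SnSubsetDichotomyNoThresholdSubsetTripleStubSwPairsAddNePairs
import Summits.MatrixMultiplication.MatrixMultiplication.Theorems.SnSubsetDichotomyNoThresholdSubsetTripleFirstRowTail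

/-!
# `SnSubsetDichotomy.NoThresholdSubsetTriple`, line `klr-graded-polynomial-method`:
# stub `degreeTailSingle_of_swPairsMDP` (the one-tableau degree tail K2′ from the moderate
# deviation J′ of the signed SW/NE pair count)

For `μ ⊢ n` let `cᵢ = residueContent 2 μ i`, `w = c₀ − (c₀ − c₁)²` (the `2`-block weight); for a
standard tableau `T` of shape `μ` with cells `(r_k, c_k)` and signs `π_k = (-1)^(r_k + c_k)` let
`S⁺(T)` (`S⁻(T)`) be the sum of `π_j π_k` over the pairs `j < k` with cell `j` strictly south-west
(north-east) of cell `k`. **J′** (the line's open statement, here a HYPOTHESIS): the same-shape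
pairs `(μ, S, T)` with `μ₁, ℓ(μ) < 3√n` and `200·(S⁺(T) − S⁻(T)) ≤ −n` number `≤ n!·e^{-c√n}` for
large `n`. **K2′** (the conclusion): the pairs whose second tableau has BKW `2`-degree outside
the middle third of `[0, w]` (`3·deg₂ T ≤ w ∨ 2w ≤ 3·deg₂ T`) number `≤ n!·e^{-c'√n}`.

Proof of `J′ → K2′` (all other inputs are tree theorems).
* U (`degreeUpperTailSmallCore_of_swPairsMDP`): a pair with `n ≤ 32w ∧ 2w ≤ 3·deg₂ T` has a
  first row `≥ 3√n` (`firstRowTail`), or a first column `≥ 3√n` (transpose injection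
  `KlrLine.card_colTail_le`), or lies in the `3√n`-box where, by `deg_eq_oddCols_sub_swPairs`
  (`deg₂ T = #odd-column cells − 2S⁺`), `stub_swPairs_add_nePairs` (`2(S⁺ + S⁻) = ξ² + n − 2n_ee`)
  and the parity bookkeeping `n_eo ≤ n_oe + μ₁`,
  `12(S⁺ − S⁻) ≤ 6μ₁ − 2w < 18√n − n/16 ≤ −12n/200` once `√n ≥ 7200` — the J′-event.
* K2′: a bad pair has `32w < n` (`smallWeightTail`), or is a U-pair, or has
  `n ≤ 32w ∧ 3·deg₂ T ≤ w`, and the transpose map (`KlrLine.exists_transposePair`: injective,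
  content-preserving, `deg₂ Tᵗ = w − deg₂ T` by `stub_transposeDegree`) sends the last kind into
  the U-pairs; `#bad ≤ #{32w < n} + 2·#U ≤ 3·n!e^{-c√n} ≤ n!e^{-(c/2)√n}`.
-/

namespace Summit.MatrixMultiplication.MatrixMultiplication.Theorems

open Literature.RepresentationTheory.FiniteGroups (TableauPair residueContent cellResidue tableauDegree)
open Literature.NumberTheory.DiophantineGeometry (StdFilling)
open scoped BigOperators

namespace KlrLine

/-- `res₂ x = 0 ↔` row and column have the same parity. [folklore] -/
private theorem cellResidue_two_eq_zero_iff (x : ℕ × ℕ) :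
    cellResidue 2 x = 0 ↔ x.2 % 2 = x.1 % 2 := by
  unfold cellResidue
  rw [sub_eq_zero, ZMod.natCast_eq_natCast_iff']

/-- Splitting a filter count along an exclusive disjunction. [folklore] -/
private theorem card_filter_eq_add {s : Finset (ℕ × ℕ)} {p q r : ℕ × ℕ → Prop} [DecidablePred p]
    [DecidablePred q] [DecidablePred r] (h : ∀ x, p x ↔ (q x ∨ r x)) (hqr : ∀ x, q x → ¬ r x) :
    (s.filter p).card = (s.filter q).card + (s.filter r).card := by
  rw [← Finset.card_union_of_disjoint (Finset.disjoint_filter.2 fun x _ hq => hqr x hq),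
    ← Finset.filter_or]
  congr 1
  exact Finset.filter_congr fun x _ => h x

/-- `c₀ = n_ee + n_oo` (`n_xy` = number of cells with row parity `x`, column parity `y`).
[folklore] -/
private theorem residueContent_two_zero_eq {n : ℕ} (μ : Nat.Partition n) :
    residueContent 2 μ 0 =
      (μ.youngDiagram.cells.filter (fun c : ℕ × ℕ => c.1 % 2 = 0 ∧ c.2 % 2 = 0)).card +
        (μ.youngDiagram.cells.filter (fun c : ℕ × ℕ => c.1 % 2 = 1 ∧ c.2 % 2 = 1)).card := by
  unfold residueContent
  exact card_filter_eq_add (fun x => by rw [cellResidue_two_eq_zero_iff]; omega) (by omega)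

/-- `c₁ = n_eo + n_oe`. [folklore] -/
private theorem residueContent_two_one_eq {n : ℕ} (μ : Nat.Partition n) :
    residueContent 2 μ 1 =
      (μ.youngDiagram.cells.filter (fun c : ℕ × ℕ => c.1 % 2 = 0 ∧ c.2 % 2 = 1)).card +
        (μ.youngDiagram.cells.filter (fun c : ℕ × ℕ => c.1 % 2 = 1 ∧ c.2 % 2 = 0)).card := by
  have hz : ∀ z : ZMod 2, z = 1 ↔ ¬ z = 0 := by decide
  unfold residueContent
  exact card_filter_eq_add (fun x => by rw [hz, cellResidue_two_eq_zero_iff]; omega) (by omega)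

/-- `O = n_eo + n_oo` (cells in odd columns). [folklore] -/
private theorem card_oddCols_eq {n : ℕ} (μ : Nat.Partition n) :
    (μ.youngDiagram.cells.filter (fun c : ℕ × ℕ => c.2 % 2 = 1)).card =
      (μ.youngDiagram.cells.filter (fun c : ℕ × ℕ => c.1 % 2 = 0 ∧ c.2 % 2 = 1)).card +
        (μ.youngDiagram.cells.filter (fun c : ℕ × ℕ => c.1 % 2 = 1 ∧ c.2 % 2 = 1)).card :=
  card_filter_eq_add (fun x => by omega) (by omega)

/-- `n = n_ee + n_eo + n_oe + n_oo` (from `c₀ + c₁ = n`). [folklore] -/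
private theorem sum_parityClass_eq {n : ℕ} (μ : Nat.Partition n) :
    (μ.youngDiagram.cells.filter (fun c : ℕ × ℕ => c.1 % 2 = 0 ∧ c.2 % 2 = 0)).card +
      (μ.youngDiagram.cells.filter (fun c : ℕ × ℕ => c.1 % 2 = 0 ∧ c.2 % 2 = 1)).card +
      (μ.youngDiagram.cells.filter (fun c : ℕ × ℕ => c.1 % 2 = 1 ∧ c.2 % 2 = 0)).card +
      (μ.youngDiagram.cells.filter (fun c : ℕ × ℕ => c.1 % 2 = 1 ∧ c.2 % 2 = 1)).card = n := by
  have h := residueContent_two_add n μ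
  rw [residueContent_two_zero_eq, residueContent_two_one_eq] at h
  omega

/-- `n_eo ≤ n_oe + μ₁`: the map `(r, c) ↦ (r − 1, c − 1)` injects the (even row, odd column) cells
off row `0` into the (odd row, even column) cells (the diagram is a lower set), and row `0` has
`μ₁` cells. [folklore] -/
private theorem parityClass_zero_one_le {n : ℕ} (μ : Nat.Partition n) :
    (μ.youngDiagram.cells.filter (fun c : ℕ × ℕ => c.1 % 2 = 0 ∧ c.2 % 2 = 1)).card ≤
      (μ.youngDiagram.cells.filter (fun c : ℕ × ℕ => c.1 % 2 = 1 ∧ c.2 % 2 = 0)).card +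
        μ.youngDiagram.rowLen 0 := by
  classical
  set A := μ.youngDiagram.cells.filter (fun c : ℕ × ℕ => c.1 % 2 = 0 ∧ c.2 % 2 = 1) with hA
  set B := μ.youngDiagram.cells.filter (fun c : ℕ × ℕ => c.1 % 2 = 1 ∧ c.2 % 2 = 0) with hB
  have hsplit := Finset.card_filter_add_card_filter_not (s := A) (p := fun c : ℕ × ℕ => c.1 = 0)
  have h0 : (A.filter (fun c : ℕ × ℕ => c.1 = 0)).card ≤ μ.youngDiagram.rowLen 0 := by
    rw [YoungDiagram.rowLen_eq_card]
    refine Finset.card_le_card fun c hc => ?_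
    simp only [hA, Finset.mem_filter, YoungDiagram.mem_cells] at hc
    exact YoungDiagram.mem_row_iff.2 ⟨hc.1.1, hc.2⟩
  have h1 : (A.filter (fun c : ℕ × ℕ => ¬ c.1 = 0)).card ≤ B.card := by
    refine Finset.card_le_card_of_injOn (fun c => (c.1 - 1, c.2 - 1)) (fun c hc => ?_)
      (fun c hc c' hc' h => ?_)
    · simp only [Finset.coe_filter, hA, Finset.mem_filter, YoungDiagram.mem_cells,
        Set.mem_setOf_eq] at hc
      simp only [hB, Finset.coe_filter, YoungDiagram.mem_cells, Set.mem_setOf_eq]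
      refine ⟨μ.youngDiagram.up_left_mem (Nat.sub_le _ _) (Nat.sub_le _ _) hc.1.1, ?_, ?_⟩ <;>
        omega
    · simp only [Finset.coe_filter, hA, Finset.mem_filter, Set.mem_setOf_eq] at hc hc'
      have h₁ : c.1 - 1 = c'.1 - 1 := congrArg Prod.fst h
      have h₂ : c.2 - 1 = c'.2 - 1 := congrArg Prod.snd h
      exact Prod.ext (by omega) (by omega)
  omega

/-- The threshold inequality: a pair with `n ≤ 32w`, `2w ≤ 3·deg₂ T` and `μ₁ < 3√n` has
`200·(S⁺(T) − S⁻(T)) ≤ −n` once `√n ≥ 7200`. By `deg_eq_oddCols_sub_swPairs` (`deg₂ T = O − 2S⁺`,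
`O = n_eo + n_oo`), `stub_swPairs_add_nePairs` (`2(S⁺ + S⁻) = ξ² + n − 2n_ee`), `c₀ = n_ee + n_oo`,
`c₁ = n_eo + n_oe` and `n_eo ≤ n_oe + μ₁`:
`12(S⁺ − S⁻) ≤ 6(n_eo − n_oe) − 2w ≤ 6μ₁ − 2w < 18√n − n/16 ≤ −12n/200`. [folklore] -/
private theorem swPairs_sub_nePairs_le {n : ℕ} (hn : (7200 : ℝ) ≤ Real.sqrt (n : ℝ))
    (i : TableauPair n)
    (h1 : (n : ℤ) ≤ 32 * ((TableauPair.content 2 i 0 : ℤ) -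
      ((TableauPair.content 2 i 0 : ℤ) - (TableauPair.content 2 i 1 : ℤ)) ^ 2))
    (h2 : 2 * ((TableauPair.content 2 i 0 : ℤ) -
      ((TableauPair.content 2 i 0 : ℤ) - (TableauPair.content 2 i 1 : ℤ)) ^ 2) ≤
        3 * tableauDegree 2 i.2.2.1)
    (hr : (i.1.youngDiagram.rowLen 0 : ℝ) < 3 * Real.sqrt (n : ℝ)) :
    200 * ((∑ k : Fin n, ∑ j ∈ Finset.univ.filter
          (fun j : Fin n => j < k ∧ (i.2.2.1 k).1 < (i.2.2.1 j).1 ∧ (i.2.2.1 j).2 < (i.2.2.1 k).2),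
        (-1 : ℤ) ^ ((i.2.2.1 j).1 + (i.2.2.1 j).2 + (i.2.2.1 k).1 + (i.2.2.1 k).2)) -
      (∑ k : Fin n, ∑ j ∈ Finset.univ.filter
          (fun j : Fin n => j < k ∧ (i.2.2.1 j).1 < (i.2.2.1 k).1 ∧ (i.2.2.1 k).2 < (i.2.2.1 j).2),
        (-1 : ℤ) ^ ((i.2.2.1 j).1 + (i.2.2.1 j).2 + (i.2.2.1 k).1 + (i.2.2.1 k).2))) ≤
      -(n : ℤ) := by
  unfold TableauPair.content at h1 h2
  have hdeg := deg_eq_oddCols_sub_swPairs n i.1 i.2.2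
  have hpair := stub_swPairs_add_nePairs n i.1 i.2.2
  set nee := (i.1.youngDiagram.cells.filter (fun c : ℕ × ℕ => c.1 % 2 = 0 ∧ c.2 % 2 = 0)).card
  set neo := (i.1.youngDiagram.cells.filter (fun c : ℕ × ℕ => c.1 % 2 = 0 ∧ c.2 % 2 = 1)).card
  set noe := (i.1.youngDiagram.cells.filter (fun c : ℕ × ℕ => c.1 % 2 = 1 ∧ c.2 % 2 = 0)).card
  set noo := (i.1.youngDiagram.cells.filter (fun c : ℕ × ℕ => c.1 % 2 = 1 ∧ c.2 % 2 = 1)).card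
  have e0 : (residueContent 2 i.1 0 : ℤ) = nee + noo := by
    exact_mod_cast residueContent_two_zero_eq i.1
  have e1 : (residueContent 2 i.1 1 : ℤ) = neo + noe := by
    exact_mod_cast residueContent_two_one_eq i.1
  have eO : ((i.1.youngDiagram.cells.filter (fun c : ℕ × ℕ => c.2 % 2 = 1)).card : ℤ) =
      neo + noo := by
    exact_mod_cast card_oddCols_eq i.1
  have en : (nee : ℤ) + neo + noe + noo = n := by exact_mod_cast sum_parityClass_eq i.1
  have hle : (neo : ℤ) ≤ noe + i.1.youngDiagram.rowLen 0 := by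
    exact_mod_cast parityClass_zero_one_le i.1
  set sp := ∑ k : Fin n, ∑ j ∈ Finset.univ.filter
      (fun j : Fin n => j < k ∧ (i.2.2.1 k).1 < (i.2.2.1 j).1 ∧ (i.2.2.1 j).2 < (i.2.2.1 k).2),
    (-1 : ℤ) ^ ((i.2.2.1 j).1 + (i.2.2.1 j).2 + (i.2.2.1 k).1 + (i.2.2.1 k).2)
  set sm := ∑ k : Fin n, ∑ j ∈ Finset.univ.filter
      (fun j : Fin n => j < k ∧ (i.2.2.1 j).1 < (i.2.2.1 k).1 ∧ (i.2.2.1 k).2 < (i.2.2.1 j).2),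
    (-1 : ℤ) ^ ((i.2.2.1 j).1 + (i.2.2.1 j).2 + (i.2.2.1 k).1 + (i.2.2.1 k).2)
  set c0 : ℤ := (residueContent 2 i.1 0 : ℤ)
  set c1 : ℤ := (residueContent 2 i.1 1 : ℤ)
  set L : ℤ := (i.1.youngDiagram.rowLen 0 : ℤ)
  -- the integer inequality `12 (sp - sm) ≤ 6 L - 2 w`
  have hZ : 12 * (sp - sm) ≤ 6 * L - 2 * (c0 - (c0 - c1) ^ 2) := by
    nlinarith [hdeg, hpair, e0, e1, eO, en, hle, h2]
  -- pass to `ℝ`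
  have hL : ((i.1.youngDiagram.rowLen 0 : ℤ) : ℝ) < 3 * Real.sqrt (n : ℝ) := by exact_mod_cast hr
  have hw : ((n : ℤ) : ℝ) ≤ 32 * (((c0 - (c0 - c1) ^ 2 : ℤ)) : ℝ) := by exact_mod_cast h1
  have hZR : (12 : ℝ) * ((sp - sm : ℤ) : ℝ) ≤
      6 * ((i.1.youngDiagram.rowLen 0 : ℤ) : ℝ) - 2 * (((c0 - (c0 - c1) ^ 2 : ℤ)) : ℝ) := by
    exact_mod_cast hZ
  have hsq : Real.sqrt (n : ℝ) * Real.sqrt (n : ℝ) = n := Real.mul_self_sqrt (Nat.cast_nonneg n)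
  have hnn : ((n : ℤ) : ℝ) = (n : ℝ) := by norm_cast
  have goalR : (200 : ℝ) * ((sp - sm : ℤ) : ℝ) ≤ -(n : ℝ) := by
    nlinarith [hZR, hL, hw, hsq, hn, Real.sqrt_nonneg (n : ℝ), hnn]
  have : ((200 * (sp - sm) : ℤ) : ℝ) ≤ ((-(n : ℤ) : ℤ) : ℝ) := by
    push_cast at goalR ⊢
    linarith
  exact_mod_cast this

/-- Counting pattern: if every `P`-element is an `R`-, a `C`- or a `J`-element and `#C ≤ #R`, then
`#P ≤ 2·#R + #J`. [folklore] -/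
private theorem natCard_le_of_cases {α : Type*} [Finite α] {P R C J : α → Prop}
    (hCR : Nat.card {i // C i} ≤ Nat.card {i // R i}) (h : ∀ i, P i → R i ∨ (C i ∨ J i)) :
    Nat.card {i // P i} ≤ 2 * Nat.card {i // R i} + Nat.card {i // J i} := by
  classical
  haveI := Fintype.ofFinite α
  simp only [Nat.card_eq_fintype_card] at hCR ⊢
  have h1 := Fintype.card_subtype_mono _ _ h
  have h2 := Fintype.card_subtype_or R (fun i => C i ∨ J i)
  have h3 := Fintype.card_subtype_or C J
  omega

/-- Counting: `#U ≤ 2·#{μ₁ ≥ 3√n} + #J′` for `√n ≥ 7200` — a U-pair has a long first row, or a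
long first column (transpose injection `card_colTail_le`), or is a boxed J′-pair
(`swPairs_sub_nePairs_le`). [folklore] -/
private theorem card_upper_le {n : ℕ} (hn : (7200 : ℝ) ≤ Real.sqrt (n : ℝ)) :
    Nat.card {i : TableauPair n //
        (n : ℤ) ≤ 32 * ((TableauPair.content 2 i 0 : ℤ) -
            ((TableauPair.content 2 i 0 : ℤ) - (TableauPair.content 2 i 1 : ℤ)) ^ 2) ∧
          2 * ((TableauPair.content 2 i 0 : ℤ) -
            ((TableauPair.content 2 i 0 : ℤ) - (TableauPair.content 2 i 1 : ℤ)) ^ 2) ≤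
            3 * tableauDegree 2 i.2.2.1} ≤
      2 * Nat.card {i : TableauPair n // 3 * Real.sqrt (n : ℝ) ≤ (i.1.youngDiagram.rowLen 0 : ℝ)} +
        Nat.card {i : TableauPair n //
          (i.1.youngDiagram.rowLen 0 : ℝ) < 3 * Real.sqrt (n : ℝ) ∧
            (i.1.youngDiagram.colLen 0 : ℝ) < 3 * Real.sqrt (n : ℝ) ∧
            200 * ((∑ k : Fin n, ∑ j ∈ Finset.univ.filter
                  (fun j : Fin n => j < k ∧ (i.2.2.1 k).1 < (i.2.2.1 j).1 ∧
                    (i.2.2.1 j).2 < (i.2.2.1 k).2),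
                (-1 : ℤ) ^ ((i.2.2.1 j).1 + (i.2.2.1 j).2 + (i.2.2.1 k).1 + (i.2.2.1 k).2)) -
              (∑ k : Fin n, ∑ j ∈ Finset.univ.filter
                  (fun j : Fin n => j < k ∧ (i.2.2.1 j).1 < (i.2.2.1 k).1 ∧
                    (i.2.2.1 k).2 < (i.2.2.1 j).2),
                (-1 : ℤ) ^ ((i.2.2.1 j).1 + (i.2.2.1 j).2 + (i.2.2.1 k).1 + (i.2.2.1 k).2))) ≤
              -(n : ℤ)} := by
  refine natCard_le_of_cases (card_colTail_le n) fun i h => ?_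
  by_cases hr : 3 * Real.sqrt (n : ℝ) ≤ (i.1.youngDiagram.rowLen 0 : ℝ)
  · exact Or.inl hr
  by_cases hc : 3 * Real.sqrt (n : ℝ) ≤ (i.1.youngDiagram.colLen 0 : ℝ)
  · exact Or.inr (Or.inl hc)
  exact Or.inr (Or.inr ⟨lt_of_not_ge hr, lt_of_not_ge hc,
    swPairs_sub_nePairs_le hn i h.1 h.2 (lt_of_not_ge hr)⟩)

/-- Constants: `3·n!e^{-c√n} ≤ n!e^{-(c/2)√n}` once `3 ≤ e^{(c/2)√n}`. [folklore] -/
private theorem three_mul_le_of_three_le_exp {c : ℝ} {n : ℕ}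
    (h3 : (3 : ℝ) ≤ Real.exp (c / 2 * Real.sqrt (n : ℝ))) :
    3 * ((n.factorial : ℝ) * Real.exp (-(c * Real.sqrt (n : ℝ)))) ≤
      (n.factorial : ℝ) * Real.exp (-(c / 2 * Real.sqrt (n : ℝ))) := by
  calc 3 * ((n.factorial : ℝ) * Real.exp (-(c * Real.sqrt (n : ℝ))))
      ≤ Real.exp (c / 2 * Real.sqrt (n : ℝ)) *
          ((n.factorial : ℝ) * Real.exp (-(c * Real.sqrt (n : ℝ)))) := by gcongr
    _ = (n.factorial : ℝ) * Real.exp (-(c / 2 * Real.sqrt (n : ℝ))) := by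
        rw [mul_left_comm, ← Real.exp_add]
        congr 1
        ring_nf

/-- Constants: `n!e^{-c'√n} ≤ n!e^{-c√n}` for `c ≤ c'`. [folklore] -/
private theorem factorial_mul_exp_mono {c c' : ℝ} (n : ℕ) (h : c ≤ c') :
    (n.factorial : ℝ) * Real.exp (-(c' * Real.sqrt (n : ℝ))) ≤
      (n.factorial : ℝ) * Real.exp (-(c * Real.sqrt (n : ℝ))) := by
  gcongr

end KlrLine

set_option linter.dupNamespace false in -- deliberate Summit.<S>.<P> duplicate
open KlrLine in
/-- **U from J′ — the one-sided degree tail off the near-staircase regime.** If the boxed J′-event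
(`μ₁, ℓ(μ) < 3√n`, `200·(S⁺(T) − S⁻(T)) ≤ −n`) has count `≤ n!e^{-c√n}` for large `n`, then the
same-shape pairs `(μ, S, T)` with `n ≤ 32w` whose second tableau has `2w ≤ 3·deg₂ T` number at
most `n!e^{-c'√n}` for large `n`: `#U ≤ 2·#{μ₁ ≥ 3√n} + #J′` (`card_upper_le`, `√n ≥ 7200`)
`≤ 3·n!e^{-c√n} ≤ n!e^{-(c/2)√n}` with `c = min c_R c_J` (`firstRowTail`). [folklore] -/
theorem degreeUpperTailSmallCore_of_swPairsMDP
    (hJ : ∃ c : ℝ, 0 < c ∧ ∃ n₀ : ℕ, ∀ n ≥ n₀,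
      (Nat.card {i : TableauPair n //
          (i.1.youngDiagram.rowLen 0 : ℝ) < 3 * Real.sqrt (n : ℝ) ∧
            (i.1.youngDiagram.colLen 0 : ℝ) < 3 * Real.sqrt (n : ℝ) ∧
            200 * ((∑ k : Fin n, ∑ j ∈ Finset.univ.filter
                  (fun j : Fin n => j < k ∧ (i.2.2.1 k).1 < (i.2.2.1 j).1 ∧
                    (i.2.2.1 j).2 < (i.2.2.1 k).2),
                (-1 : ℤ) ^ ((i.2.2.1 j).1 + (i.2.2.1 j).2 + (i.2.2.1 k).1 + (i.2.2.1 k).2)) -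
              (∑ k : Fin n, ∑ j ∈ Finset.univ.filter
                  (fun j : Fin n => j < k ∧ (i.2.2.1 j).1 < (i.2.2.1 k).1 ∧
                    (i.2.2.1 k).2 < (i.2.2.1 j).2),
                (-1 : ℤ) ^ ((i.2.2.1 j).1 + (i.2.2.1 j).2 + (i.2.2.1 k).1 + (i.2.2.1 k).2))) ≤
              -(n : ℤ)} : ℝ) ≤
        (n.factorial : ℝ) * Real.exp (-(c * Real.sqrt (n : ℝ)))) :
    ∃ c : ℝ, 0 < c ∧ ∃ n₀ : ℕ, ∀ n ≥ n₀,
      (Nat.card {i : TableauPair n //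
          (n : ℤ) ≤ 32 * ((TableauPair.content 2 i 0 : ℤ) -
              ((TableauPair.content 2 i 0 : ℤ) - (TableauPair.content 2 i 1 : ℤ)) ^ 2) ∧
            2 * ((TableauPair.content 2 i 0 : ℤ) -
              ((TableauPair.content 2 i 0 : ℤ) - (TableauPair.content 2 i 1 : ℤ)) ^ 2) ≤
              3 * tableauDegree 2 i.2.2.1} : ℝ) ≤
        (n.factorial : ℝ) * Real.exp (-(c * Real.sqrt (n : ℝ))) := by
  obtain ⟨cR, hcR, nR, hR⟩ := firstRowTail
  obtain ⟨cJ, hcJ, nJ, hJ'⟩ := hJ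
  set c := min cR cJ with hcdef
  have hc : 0 < c := lt_min hcR hcJ
  obtain ⟨n₁, hn₁⟩ := exists_three_le_exp hc
  refine ⟨c / 2, half_pos hc, max (max (max nR nJ) n₁) (7200 ^ 2), fun n hn => ?_⟩
  obtain ⟨⟨⟨hnR, hnJ⟩, hn₁'⟩, hn'⟩ : ((nR ≤ n ∧ nJ ≤ n) ∧ n₁ ≤ n) ∧ 7200 ^ 2 ≤ n := by
    simpa only [ge_iff_le, max_le_iff] using hn
  have h3 := three_mul_le_of_three_le_exp (hn₁ n hn₁')
  have h7200 : (7200 : ℝ) ≤ Real.sqrt (n : ℝ) :=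
    le_sqrt_of_sq_le (by norm_num) (by exact_mod_cast hn')
  have hcount := Nat.cast_le (α := ℝ) |>.2 (card_upper_le (n := n) h7200)
  push_cast at hcount
  have hRn := (hR n hnR).trans (factorial_mul_exp_mono n (min_le_left cR cJ))
  have hJn := (hJ' n hnJ).trans (factorial_mul_exp_mono n (min_le_right cR cJ))
  linarith [hcount, hRn, hJn, h3]

namespace KlrLine

/-- Counting: `#{n ≤ 32w ∧ 3·deg₂ T ≤ w} ≤ #{n ≤ 32w ∧ 2w ≤ 3·deg₂ T}` — the transpose map
`(μ, S, T) ↦ (μᵗ, Sᵗ, Tᵗ)` (`exists_transposePair`) is injective, preserves the `2`-content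
(`residueContent_transpose`), and `deg₂ Tᵗ = w − deg₂ T` (`stub_transposeDegree`). [folklore] -/
private theorem card_lower_le (n : ℕ) :
    Nat.card {i : TableauPair n //
        (n : ℤ) ≤ 32 * ((TableauPair.content 2 i 0 : ℤ) -
            ((TableauPair.content 2 i 0 : ℤ) - (TableauPair.content 2 i 1 : ℤ)) ^ 2) ∧
          3 * tableauDegree 2 i.2.2.1 ≤
            (TableauPair.content 2 i 0 : ℤ) -
              ((TableauPair.content 2 i 0 : ℤ) - (TableauPair.content 2 i 1 : ℤ)) ^ 2} ≤
      Nat.card {i : TableauPair n //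
        (n : ℤ) ≤ 32 * ((TableauPair.content 2 i 0 : ℤ) -
            ((TableauPair.content 2 i 0 : ℤ) - (TableauPair.content 2 i 1 : ℤ)) ^ 2) ∧
          2 * ((TableauPair.content 2 i 0 : ℤ) -
            ((TableauPair.content 2 i 0 : ℤ) - (TableauPair.content 2 i 1 : ℤ)) ^ 2) ≤
            3 * tableauDegree 2 i.2.2.1} := by
  classical
  haveI : Fintype (TableauPair n) := Fintype.ofFinite _
  obtain ⟨τ, hτ, hτ'⟩ := exists_transposePair n
  have hcontent : ∀ (i : TableauPair n) (j : ZMod 2),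
      TableauPair.content 2 (τ i) j = TableauPair.content 2 i j := fun i j => by
    unfold TableauPair.content
    rw [(hτ' i).1, residueContent_transpose]
  have hdeg : ∀ i : TableauPair n, tableauDegree 2 (τ i).2.2.1 =
      (TableauPair.content 2 i 0 : ℤ) -
          ((TableauPair.content 2 i 0 : ℤ) - (TableauPair.content 2 i 1 : ℤ)) ^ 2 -
        tableauDegree 2 i.2.2.1 := fun i => by
    have h := stub_transposeDegree n i.1 i.2.2
    rw [(hτ' i).2.2]
    unfold TableauPair.content
    linarith
  simp only [Nat.card_eq_fintype_card]
  refine Fintype.card_le_of_injective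
    (fun i => ⟨τ i.1, by
      obtain ⟨h1, h2⟩ := i.2
      refine ⟨?_, ?_⟩
      · simp only [hcontent]; exact h1
      · simp only [hcontent, hdeg]; linarith⟩) fun i j h => ?_
  exact Subtype.ext (hτ (congrArg Subtype.val h))

/-- The case split behind K2′, as integer arithmetic: `3d ≤ w ∨ 2w ≤ 3d` forces
`m ≤ 32w ∧ 2w ≤ 3d`, or `m ≤ 32w ∧ 3d ≤ w`, or `32w < m`. [folklore] -/
private theorem bad_cases_arith (m w d : ℤ) (h : 3 * d ≤ w ∨ 2 * w ≤ 3 * d) :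
    (m ≤ 32 * w ∧ 2 * w ≤ 3 * d) ∨ ((m ≤ 32 * w ∧ 3 * d ≤ w) ∨ 32 * w < m) := by
  omega

/-- Counting: `#{3·deg₂ T ≤ w ∨ 2w ≤ 3·deg₂ T} ≤ 2·#{n ≤ 32w ∧ 2w ≤ 3·deg₂ T} + #{32w < n}`
(`bad_cases_arith` and the transpose injection `card_lower_le`). [folklore] -/
private theorem card_bad_le (n : ℕ) :
    Nat.card {i : TableauPair n //
        3 * tableauDegree 2 i.2.2.1 ≤
            (TableauPair.content 2 i 0 : ℤ) -
              ((TableauPair.content 2 i 0 : ℤ) - (TableauPair.content 2 i 1 : ℤ)) ^ 2 ∨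
          2 * ((TableauPair.content 2 i 0 : ℤ) -
              ((TableauPair.content 2 i 0 : ℤ) - (TableauPair.content 2 i 1 : ℤ)) ^ 2) ≤
            3 * tableauDegree 2 i.2.2.1} ≤
      2 * Nat.card {i : TableauPair n //
          (n : ℤ) ≤ 32 * ((TableauPair.content 2 i 0 : ℤ) -
              ((TableauPair.content 2 i 0 : ℤ) - (TableauPair.content 2 i 1 : ℤ)) ^ 2) ∧
            2 * ((TableauPair.content 2 i 0 : ℤ) -
              ((TableauPair.content 2 i 0 : ℤ) - (TableauPair.content 2 i 1 : ℤ)) ^ 2) ≤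
              3 * tableauDegree 2 i.2.2.1} +
        Nat.card {i : TableauPair n // 32 * ((TableauPair.content 2 i 0 : ℤ) -
          ((TableauPair.content 2 i 0 : ℤ) - (TableauPair.content 2 i 1 : ℤ)) ^ 2) < (n : ℤ)} :=
  natCard_le_of_cases (card_lower_le n) fun _ h => bad_cases_arith _ _ _ h

end KlrLine

set_option linter.dupNamespace false in -- deliberate Summit.<S>.<P> duplicate
open KlrLine in
/-- **Stub `degreeTailSingle_of_swPairsMDP` (line `klr-graded-polynomial-method`, crux
`SnSubsetDichotomy.NoThresholdSubsetTriple`, stmt-MatrixMultiplication-8302): the one-tableau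
degree tail K2′ from the moderate deviation J′.** If the boxed J′-event (`μ₁, ℓ(μ) < 3√n`,
`200·(S⁺(T) − S⁻(T)) ≤ −n`) has count `≤ n!e^{-c√n}` for large `n`, then, with
`cᵢ = TableauPair.content 2 i` and `w = c₀ − (c₀ − c₁)²`, the same-shape pairs of standard
tableaux `(μ, S, T)` whose second tableau has its BKW `2`-degree outside the middle third of
`[0, w]` (`3·deg₂ T ≤ w ∨ 2w ≤ 3·deg₂ T`) number at most `n!e^{-c'√n}` for large `n`:
`#bad ≤ #{32w < n} + 2·#U` (`card_bad_le`: case split and transpose injection)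
`≤ 3·n!e^{-c√n} ≤ n!e^{-(c/2)√n}` (`smallWeightTail`, `degreeUpperTailSmallCore_of_swPairsMDP`,
`c = min c_W c_U`). [folklore] -/
theorem degreeTailSingle_of_swPairsMDP : (∃ c : ℝ, 0 < c ∧ ∃ n₀ : ℕ, ∀ n ≥ n₀, (Nat.card {i : TableauPair n // (i.1.youngDiagram.rowLen 0 : ℝ) < 3 * Real.sqrt (n : ℝ) ∧ (i.1.youngDiagram.colLen 0 : ℝ) < 3 * Real.sqrt (n : ℝ) ∧ 200 * ((∑ k : Fin n, ∑ j ∈ Finset.univ.filter (fun j : Fin n => j < k ∧ (i.2.2.1 k).1 < (i.2.2.1 j).1 ∧ (i.2.2.1 j).2 < (i.2.2.1 k).2), (-1 : ℤ) ^ ((i.2.2.1 j).1 + (i.2.2.1 j).2 + (i.2.2.1 k).1 + (i.2.2.1 k).2)) - (∑ k : Fin n, ∑ j ∈ Finset.univ.filter (fun j : Fin n => j < k ∧ (i.2.2.1 j).1 < (i.2.2.1 k).1 ∧ (i.2.2.1 k).2 < (i.2.2.1 j).2), (-1 : ℤ) ^ ((i.2.2.1 j).1 + (i.2.2.1 j).2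 + (i.2.2.1 k).1 + (i.2.2.1 k).2))) ≤ -(n : ℤ)} : ℝ) ≤ (n.factorial : ℝ) * Real.exp (-(c * Real.sqrt (n : ℝ)))) → ∃ c : ℝ, 0 < c ∧ ∃ n₀ : ℕ, ∀ n ≥ n₀, (Nat.card {i : TableauPair n // 3 * Literature.RepresentationTheory.FiniteGroups.tableauDegree 2 i.2.2.1 ≤ (TableauPair.content 2 i 0 : ℤ) - ((TableauPair.content 2 i 0 : ℤ) - (TableauPair.content 2 i 1 : ℤ)) ^ 2 ∨ 2 * ((TableauPair.content 2 i 0 : ℤ) - ((TableauPair.content 2 i 0 : ℤ) - (TableauPair.content 2 i 1 : ℤ)) ^ 2) ≤ 3 * Literature.RepresentationTheory.FiniteGroups.tableauDegree 2 i.2.2.1} : ℝ) ≤ (n.factorial : ℝ) * Real.exp (-(c * Real.sqrt (n : ℝ))) := by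
  intro hJ
  obtain ⟨cC, hcC, nC, hC⟩ := smallWeightTail
  obtain ⟨cU, hcU, nU, hU⟩ := degreeUpperTailSmallCore_of_swPairsMDP hJ
  set c := min cC cU with hcdef
  have hc : 0 < c := lt_min hcC hcU
  obtain ⟨n₁, hn₁⟩ := exists_three_le_exp hc
  refine ⟨c / 2, half_pos hc, max (max nC nU) n₁, fun n hn => ?_⟩
  obtain ⟨⟨hnC, hnU⟩, hn₁'⟩ : (nC ≤ n ∧ nU ≤ n) ∧ n₁ ≤ n := by
    simpa only [ge_iff_le, max_le_iff] using hn
  have h3 := three_mul_le_of_three_le_exp (hn₁ n hn₁')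
  have hcount := Nat.cast_le (α := ℝ) |>.2 (card_bad_le n)
  push_cast at hcount
  have hCn := (hC n hnC).trans (factorial_mul_exp_mono n (min_le_left cC cU))
  have hUn := (hU n hnU).trans (factorial_mul_exp_mono n (min_le_right cC cU))
  linarith [hcount, hCn, hUn, h3]

end Summit.MatrixMultiplication.MatrixMultiplication.Theorems
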